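import Mathlib
import Summits.ResolutionOfSingularities.ResolutionOfSingularities.Theorems.RadicialJungCleanModelsCleanLU3ArcQConst
import HarnessLib

/-!
# Route `RadicialJung`, crux `CleanModels` (stmt-15917), stub `stub_cleanLU3DefectArcInfinite`: REPRESENTING an element of a local
# ring modulo `𝔪^N` by a polynomial in the generators of `𝔪` with `Q`-CONSTANT coefficients; derivations and powers of `𝔪`

Line `Sketch` rev 20 of crux stmt-ResolutionOfSingularities-15917; lead `res-B-lead-1` g3.  OURS; nothing here proves resolution in
characteristic `p`.

For a local subring `R ⊆ K` (char `p`) dominated by a valuation ring `O`, with `𝔪_R = (x_1, …, x_n)` and every residue a `p`-th power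
(`hperf`), and `Q = p^s`:

* `exists_mvPolynomial_rep` — **every `r ∈ R` is `H(x) + m` with `H` a polynomial whose coefficients are `Q`-th powers of elements of
  `R` and `m ∈ 𝔪_R^N`** (the algebraic, truncated substitute for the Cohen/Teichmüller expansion in `R̂ ≅ κ[[x]]`).
* `valuation_le_pow_of_mem_pow` — elements of `𝔪_R^n` have value `≤ (v π)^n` when `v π` bounds every value `< 1`.
* `derivation_apply_mem_pow` — a derivation `s • D` preserving `R` maps `𝔪_R^(n+1)` into `𝔪_R^n`.
* `derivation_apply_qconst` — derivations kill `Q`-constants.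
-/

noncomputable section

set_option linter.dupNamespace false -- mandated namespace of this single-conjunct summit

open IsLocalRing MvPolynomial
open Literature.AlgebraicGeometry.Resolution

namespace Summit.ResolutionOfSingularities.ResolutionOfSingularities.Theorems.RadicialJung.CleanModels

variable {K : Type} [Field K]

/-! ## Powers of the maximal ideal: values and derivations -/

/-- Along a dominated local subring, elements of `𝔪^n` have value `≤ (v π)^n` when `v π` bounds every value `< 1`. [folklore] -/
theorem valuation_le_pow_of_mem_pow {O : ValuationSubring K} {R : Subring K} [IsLocalRing R]
    (hdom : SubringDominates R O.toSubring) (π : K) (hπ : ∀ x : K, O.valuation x < 1 → O.valuation x ≤ O.valuation π) :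
    ∀ (n : ℕ) (m : R), m ∈ maximalIdeal R ^ n → O.valuation (m : K) ≤ O.valuation π ^ n := by
  have hmem : ∀ a : R, a ∈ maximalIdeal R ↔ O.valuation (a : K) < 1 := (subringDominates_valuationSubring_iff hdom.1).mp hdom
  have hle1 : ∀ a : R, O.valuation (a : K) ≤ 1 := fun a => (O.valuation_le_one_iff _).mpr (hdom.1 a.2)
  intro n
  induction n with
  | zero => intro m _; rw [pow_zero]; exact hle1 m
  | succ n ih =>
    intro m hm
    rw [pow_succ] at hm
    refine Submodule.mul_induction_on hm (fun a ha b hb => ?_) (fun a b ha hb => ?_)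
    · rw [Subring.coe_mul, map_mul, pow_succ]
      exact mul_le_mul' (ih a ha) (hπ _ ((hmem b).mp hb))
    · rw [Subring.coe_add]
      exact (Valuation.map_add _ _ _).trans (max_le ha hb)

/-- A derivation-multiple `s • D` preserving the local subring `R` maps `𝔪_R^(n+1)` into `𝔪_R^n`. [folklore] -/
theorem derivation_apply_mem_pow (D : Derivation ℤ K K) (s : K) {R : Subring K} [IsLocalRing R]
    (hD : ∀ y ∈ R, s * D y ∈ R) :
    ∀ (n : ℕ) (m : R), m ∈ maximalIdeal R ^ (n + 1) → (⟨s * D (m : K), hD _ m.2⟩ : R) ∈ maximalIdeal R ^ n := by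
  have hadd : ∀ a b : R, (⟨s * D ((a + b : R) : K), hD _ (a + b).2⟩ : R) = ⟨s * D (a : K), hD _ a.2⟩ + ⟨s * D (b : K), hD _ b.2⟩ :=
    fun a b => Subtype.ext (by change s * D ((a : K) + (b : K)) = s * D (a : K) + s * D (b : K); rw [map_add, mul_add])
  have hmul : ∀ a b : R, (⟨s * D ((a * b : R) : K), hD _ (a * b).2⟩ : R) =
      a * ⟨s * D (b : K), hD _ b.2⟩ + b * ⟨s * D (a : K), hD _ a.2⟩ := fun a b => Subtype.ext (by
    change s * D ((a : K) * (b : K)) = (a : K) * (s * D (b : K)) + (b : K) * (s * D (a : K))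
    rw [Derivation.leibniz, smul_eq_mul, smul_eq_mul]; ring)
  intro n
  induction n with
  | zero => intro m _; rw [pow_zero, Ideal.one_eq_top]; trivial
  | succ n ih =>
    intro m hm
    rw [pow_succ] at hm
    refine Submodule.mul_induction_on hm (fun a ha b hb => ?_) (fun a b ha hb => ?_)
    · rw [hmul, pow_succ]
      refine Ideal.add_mem _ ?_ ?_
      · -- `a ∈ 𝔪^(n+1)`, `s D b ∈ R`: `a · sDb ∈ 𝔪^(n+1) ⊆`? we need `𝔪^n * 𝔪`: use `a ∈ 𝔪^(n+1) = 𝔪^n * 𝔪`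
        have : a * (⟨s * D (b : K), hD _ b.2⟩ : R) ∈ maximalIdeal R ^ (n + 1) := Ideal.mul_mem_right _ _ ha
        rwa [pow_succ] at this
      · rw [mul_comm b]; exact Ideal.mul_mem_mul (ih a ha) hb
    · rw [hadd]; exact Ideal.add_mem _ ha hb

/-! ## `Q`-constants of a subring and derivations -/

section QConst

variable {p : ℕ} [hp : Fact p.Prime] [CharP K p]

/-- Membership in the subring of `Q`-th powers of `R` (`Q = p^s`). [folklore] -/
theorem mem_map_iterateFrobenius_iff (R : Subring K) (s : ℕ) (y : K) :
    y ∈ R.map (iterateFrobenius K p s) ↔ ∃ r : K, r ∈ R ∧ r ^ p ^ s = y := by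
  rw [Subring.mem_map]
  constructor
  · rintro ⟨r, hr, rfl⟩; exact ⟨r, hr, (iterateFrobenius_def ..).symm⟩
  · rintro ⟨r, hr, rfl⟩; exact ⟨r, hr, iterateFrobenius_def ..⟩

/-- `Q`-constants of `R` lie in `R`. [folklore] -/
theorem map_iterateFrobenius_le (R : Subring K) (s : ℕ) : R.map (iterateFrobenius K p s) ≤ R := by
  intro y hy
  obtain ⟨r, hr, rfl⟩ := (mem_map_iterateFrobenius_iff R s y).mp hy
  exact R.pow_mem hr _

/-- Derivations kill `Q`-constants (`Q = p^s`, `s ≠ 0`). [folklore] -/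
theorem derivation_apply_qconst (D : Derivation ℤ K K) (R : Subring K) {s : ℕ} (hs : s ≠ 0) (t : R.map (iterateFrobenius K p s)) :
    D (algebraMap (R.map (iterateFrobenius K p s)) K t) = 0 := by
  obtain ⟨r, -, hr⟩ := (mem_map_iterateFrobenius_iff R s (t : K)).mp t.2
  change D (t : K) = 0
  rw [← hr, Derivation.leibniz_pow]
  have : ((p ^ s : ℕ) : K) = 0 := by rw [Nat.cast_pow, CharP.cast_eq_zero K p, zero_pow hs]
  simp [this]

/-! ## Representation modulo `𝔪^N` by `Q`-constant-coefficient polynomials -/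

/-- **Representation lemma.** `R ⊆ O` local, dominated, `𝔪_R = (x_i)`, every element of `R` a `p`-th power modulo the centre.  Then
every `r ∈ R` is, for every `N`, of the form `H(x) + m` with `H` a polynomial over the `Q`-constants of `R` (`Q = p^s`) and
`m ∈ 𝔪_R^N`. [folklore] -/
theorem exists_mvPolynomial_rep {O : ValuationSubring K} {R : Subring K} [IsLocalRing R] (hdom : SubringDominates R O.toSubring)
    (hperf : ∀ b : K, b ∈ R → ∃ t : K, t ∈ R ∧ O.valuation (b - t ^ p) < 1) (s : ℕ) {n : ℕ} (x : Fin n → R)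
    (hx : maximalIdeal R = Ideal.span (Set.range x)) :
    ∀ (N : ℕ) (r : R), ∃ (H : MvPolynomial (Fin n) (R.map (iterateFrobenius K p s))) (m : R),
      m ∈ maximalIdeal R ^ N ∧ (r : K) = aeval (fun i => (x i : K)) H + m := by
  have hmem : ∀ a : R, a ∈ maximalIdeal R ↔ O.valuation (a : K) < 1 := (subringDominates_valuationSubring_iff hdom.1).mp hdom
  have hperfQ := exists_sub_pow_pow_lt_subring O R hperf s
  intro N
  induction N with
  | zero => intro r; exact ⟨0, r, by rw [pow_zero, Ideal.one_eq_top]; trivial, by simp⟩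
  | succ N ih =>
    intro r
    obtain ⟨t, ht, hvt⟩ := hperfQ r r.2
    -- `r - t^Q ∈ 𝔪 = (x_i)`
    have hm1 : (⟨(r : K) - t ^ p ^ s, R.sub_mem r.2 (R.pow_mem ht _)⟩ : R) ∈ maximalIdeal R := (hmem _).mpr hvt
    rw [hx] at hm1
    obtain ⟨c, hc⟩ := (Ideal.mem_span_range_iff_exists_fun).mp hm1
    -- represent each `c i` modulo `𝔪^N`
    choose H m hmN hcm using fun i => ih (c i)
    let tQ : R.map (iterateFrobenius K p s) := ⟨t ^ p ^ s, (mem_map_iterateFrobenius_iff R s _).mpr ⟨t, ht, rfl⟩⟩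
    refine ⟨C tQ + ∑ i, X i * H i, ∑ i, x i * m i, ?_, ?_⟩
    · rw [pow_succ']
      exact Ideal.sum_mem _ fun i _ => Ideal.mul_mem_mul (by rw [hx]; exact Ideal.subset_span ⟨i, rfl⟩) (hmN i)
    · have hc' : (r : K) - t ^ p ^ s = ∑ i, (c i : K) * (x i : K) := by
        have := congrArg (fun z : R => (z : K)) hc
        simp only [AddSubmonoidClass.coe_finsetSum, Subring.coe_mul] at this
        exact this.symm
      have htQ : algebraMap (R.map (iterateFrobenius K p s)) K tQ = t ^ p ^ s := rfl
      simp only [map_add, map_sum, map_mul, MvPolynomial.aeval_C, MvPolynomial.aeval_X, AddSubmonoidClass.coe_finsetSum,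
        Subring.coe_mul, htQ]
      calc (r : K) = t ^ p ^ s + ∑ i, (c i : K) * (x i : K) := by rw [← hc']; ring
        _ = t ^ p ^ s + ∑ i, ((x i : K) * aeval (fun i => (x i : K)) (H i) + (x i : K) * (m i : K)) := by
          congr 1
          exact Finset.sum_congr rfl fun i _ => by rw [hcm i]; ring
        _ = t ^ p ^ s + ∑ i, (x i : K) * aeval (fun i => (x i : K)) (H i) + ∑ i, (x i : K) * (m i : K) := by
          rw [Finset.sum_add_distrib, add_assoc]

end QConst

end Summit.ResolutionOfSingularities.ResolutionOfSingularities.Theorems.RadicialJung.CleanModels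

end
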